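import Mathlib.Analysis.SpecialFunctions.Exp
import HarnessLib

/-!
# Uniqueness theorem for general Dirichlet series (separated exponents, bounded coefficients)

Topic `Literature/Analysis/Complex`. Everything here is PROVED (no named facts, no definitions).

**The theorem** (`eq_zero_of_generalDirichlet_hasSum_zero`). Let `y : ℕ → ℝ` be a
sequence of exponents with uniform gaps, `y (n+1) ≥ y n + δ` for a fixed `δ > 0`, and let
`c : ℕ → ℂ` be bounded coefficients, `‖c n‖ ≤ M`. If the general Dirichlet series
`∑ₙ c n · e^{-s yₙ}` sums to `0` for every real `s > s₀`, then `c n = 0` for all `n`. This is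
the uniqueness theorem for general Dirichlet series `∑ aₙ e^{-λₙ s}` (Hardy–Riesz, Thm 6) in
the absolutely convergent, bounded-coefficient case; for `yₙ = log n` it is the familiar
uniqueness theorem for ordinary Dirichlet series (Apostol, Thm 11.3). No analytic
continuation is involved: only real `s → +∞`.

**Proof outline.**
1. From the gap hypothesis, `y (m + n + 1) ≥ y n + (m + 1) δ` (`le_seq_of_gap`, induction).
2. Strong induction on `n`: assume `c m = 0` for `m < n`. Splitting off the first `n + 1`
   terms (`hasSum_nat_add_iff'`), the tail `∑ₘ c (m+n+1) e^{-s y (m+n+1)}` has sum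
   `-c n · e^{-s yₙ}`.
3. For `s > max s₀ 0` the tail is dominated termwise by the geometric series
   `M e^{-s yₙ} ∑ₘ u^{m+1}`, `u = e^{-s δ} < 1` (`HasSum.norm_le_of_bounded`), whence
   `‖c n‖ ≤ M u (1 - u)⁻¹` after cancelling `e^{-s yₙ} > 0`.
4. As `s → +∞`, `u → 0` (`Real.tendsto_exp_atBot`), so the right-hand side tends to `0`
   and `‖c n‖ ≤ 0` (`ge_of_tendsto`).

## References

* G. H. Hardy, M. Riesz, *The General Theory of Dirichlet's Series*, Cambridge Tracts in
  Mathematics 18 (1915), §II.6, Theorem 6 (uniqueness of the coefficients of a general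
  Dirichlet series).
* T. M. Apostol, *Introduction to Analytic Number Theory*, Springer (1976), Theorem 11.3
  (uniqueness theorem for ordinary Dirichlet series, the special case `λₙ = log n`). [folklore]
-/

open Filter Topology

namespace Literature.Analysis.Complex

/-- **Linear growth of gapped exponents.** If `y (k+1) ≥ y k + δ` for all `k`, then
`y (m + (n + 1)) ≥ y n + (m + 1) δ` for all `n m`. [folklore] -/
theorem le_seq_of_gap {y : ℕ → ℝ} {δ : ℝ} (hy : ∀ n : ℕ, y n + δ ≤ y (n + 1)) (n : ℕ) :
    ∀ m : ℕ, y n + (m + 1) * δ ≤ y (m + (n + 1))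
  | 0 => by simpa using hy n
  | m + 1 => by
    have ih := le_seq_of_gap hy n m
    have h1 := hy (m + (n + 1))
    have e : m + 1 + (n + 1) = m + (n + 1) + 1 := by omega
    rw [e]
    push_cast at ih ⊢
    linarith

/-- **Uniqueness theorem for general Dirichlet series** (Hardy–Riesz 1915, Thm 6, in the
absolutely convergent bounded-coefficient case). Let the exponents `y n` have uniform gaps
`y (n+1) ≥ y n + δ`, `δ > 0`, and let the coefficients be bounded, `‖c n‖ ≤ M`. If
`∑ₙ c n · e^{-s · y n} = 0` (as a convergent series) for every real `s > s₀`, then every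
coefficient vanishes. Proof: peel off the first non-zero coefficient and let `s → +∞`; the
tail is `O(e^{-s (yₙ + δ)})` by comparison with a geometric series. [folklore] -/
theorem eq_zero_of_generalDirichlet_hasSum_zero {y : ℕ → ℝ} {c : ℕ → ℂ} {δ M s₀ : ℝ}
    (hδ : 0 < δ) (hy : ∀ n : ℕ, y n + δ ≤ y (n + 1)) (hc : ∀ n : ℕ, ‖c n‖ ≤ M)
    (h : ∀ s : ℝ, s₀ < s → HasSum (fun n : ℕ => c n * (Real.exp (-s * y n) : ℂ)) 0) :
    ∀ n : ℕ, c n = 0 := by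
  have hM : 0 ≤ M := (norm_nonneg _).trans (hc 0)
  intro n
  induction n using Nat.strong_induction_on with
  | _ n ih =>
  -- Step 1: the key estimate `‖c n‖ ≤ M u (1 - u)⁻¹`, `u = e^{-s δ}`, for `s > max s₀ 0`.
  have key : ∀ s : ℝ, s₀ < s → 0 < s →
      ‖c n‖ ≤ M * (Real.exp (-s * δ) * (1 - Real.exp (-s * δ))⁻¹) := by
    intro s hs hs0
    set u : ℝ := Real.exp (-s * δ) with hu
    have hu0 : 0 < u := Real.exp_pos _
    have hu1 : u < 1 := by
      rw [hu, Real.exp_lt_one_iff]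
      have := mul_pos hs0 hδ
      linarith
    set f : ℕ → ℂ := fun k => c k * (Real.exp (-s * y k) : ℂ) with hf
    have hfs : HasSum f 0 := h s hs
    have htail : HasSum (fun m : ℕ => f (m + (n + 1)))
        (0 - ∑ i ∈ Finset.range (n + 1), f i) :=
      (hasSum_nat_add_iff' (n + 1)).mpr hfs
    have hfin : ∑ i ∈ Finset.range (n + 1), f i = f n := by
      rw [Finset.sum_range_succ, Finset.sum_eq_zero, zero_add]
      intro i hi
      simp only [hf, ih i (Finset.mem_range.mp hi), zero_mul]
    rw [hfin, zero_sub] at htail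
    have hnorm : ∀ k : ℕ, ‖f k‖ = ‖c k‖ * Real.exp (-s * y k) := fun k => by
      simp only [hf, norm_mul, Complex.norm_real, Real.norm_eq_abs, Real.abs_exp]
    -- the geometric majorant
    have hg : HasSum (fun m : ℕ => M * Real.exp (-s * y n) * (u * u ^ m))
        (M * Real.exp (-s * y n) * (u * (1 - u)⁻¹)) :=
      ((hasSum_geometric_of_lt_one hu0.le hu1).mul_left u).mul_left _
    have hle : ∀ m : ℕ, ‖f (m + (n + 1))‖ ≤ M * Real.exp (-s * y n) * (u * u ^ m) := by
      intro m
      rw [hnorm]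
      have hym : y n + (m + 1) * δ ≤ y (m + (n + 1)) := le_seq_of_gap hy n m
      calc ‖c (m + (n + 1))‖ * Real.exp (-s * y (m + (n + 1)))
          ≤ M * Real.exp (-s * y (m + (n + 1))) :=
            mul_le_mul_of_nonneg_right (hc _) (Real.exp_pos _).le
        _ ≤ M * Real.exp (-s * (y n + (m + 1) * δ)) := by
            refine mul_le_mul_of_nonneg_left (Real.exp_le_exp.mpr ?_) hM
            have := mul_le_mul_of_nonneg_left hym hs0.le
            linarith
        _ = M * Real.exp (-s * y n) * (u * u ^ m) := by
            have e : -s * (y n + (m + 1) * δ) = -s * y n + ((m : ℝ) * (-s * δ) + -s * δ) := by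
              ring
            rw [e, Real.exp_add, Real.exp_add, Real.exp_nat_mul, ← hu]
            ring
    have hbound := htail.norm_le_of_bounded hg hle
    rw [norm_neg, hnorm] at hbound
    have hpos : 0 < Real.exp (-s * y n) := Real.exp_pos _
    refine le_of_mul_le_mul_right ?_ hpos
    calc ‖c n‖ * Real.exp (-s * y n)
        ≤ M * Real.exp (-s * y n) * (u * (1 - u)⁻¹) := hbound
      _ = M * (u * (1 - u)⁻¹) * Real.exp (-s * y n) := by ring
  -- Step 2: let `s → +∞`.
  have hu : Tendsto (fun s : ℝ => Real.exp (-s * δ)) atTop (𝓝 0) := by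
    have h1 : Tendsto (fun s : ℝ => -s * δ) atTop atBot :=
      tendsto_neg_atTop_atBot.atBot_mul_const hδ
    exact Real.tendsto_exp_atBot.comp h1
  have hlim : Tendsto (fun s : ℝ => M * (Real.exp (-s * δ) * (1 - Real.exp (-s * δ))⁻¹))
      atTop (𝓝 0) := by
    have h1 : Tendsto (fun s : ℝ => 1 - Real.exp (-s * δ)) atTop (𝓝 (1 - 0)) :=
      tendsto_const_nhds.sub hu
    have := (hu.mul (h1.inv₀ (by norm_num))).const_mul M
    simpa using this
  have hev : ∀ᶠ s : ℝ in atTop,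
      ‖c n‖ ≤ M * (Real.exp (-s * δ) * (1 - Real.exp (-s * δ))⁻¹) := by
    filter_upwards [eventually_gt_atTop s₀, eventually_gt_atTop 0] with s hs hs0
    exact key s hs hs0
  exact norm_le_zero_iff.mp (ge_of_tendsto hlim hev)

end Literature.Analysis.Complex
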